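import Mathlib
import Literature.MathematicalPhysics.QuantumFieldTheory.Balaban1983to89.B16PostRGeom

/-!
# `Balaban1983to89.B16OuterCollar` — [Balaban1989LargeFieldII] p. 378: the support identity behind *"χ_k(X_i~⁻⁶) …
combined with the function χ_k(Ω_k~⁴)"* needs only the OUTER half of the local collar picture, KERNEL-CHECKED as finite set
algebra (cell `GAPS.md` row C-pv10-19 (c); companion of G-B16-15 / D-b02.13 (iii); sibling of `…B16PostRGeom`)

CITATION HEADER (lean-in-tree rule 2026-08-18).  Source: T. Bałaban, *Large field renormalization. II. Localization,
exponentiation, and bounds for the 𝐑 operation*, Commun. Math. Phys. **122**, 355–392 (1989) [Balaban1989LargeFieldII]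
(cell paper B16; held `paper:balaban1989-cmp122-large-field-ii`, journal page = PDF page + 354; quotations read on the x2
renders `b2b-balaban-ref1/pages/1989-cmp122-large-field-II/…-p024/p025-x2.png`), with T. Bałaban, *Convergent
renormalization expansions for lattice gauge theories*, Commun. Math. Phys. **119**, 243–285 (1988) [Balaban1988Convergent]
(= [III], cell paper B14; renders `…/1988-cmp119-convergent-renormalization/…-p013/p014/p027-x2.png`) and *Large field
renormalization. I*, Commun. Math. Phys. **122**, 175–202 (1989) [Balaban1989LargeFieldI] (= [IV], cell paper B15; render
`…/1989-cmp122-large-field-I/…-p003-x2.png`).  The papers are manuscripts UNDER ADJUDICATION by the audit cell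
`pub-balaban`: NOTHING printed in them is asserted here; every `theorem` below is finite set algebra on `ℤᵈ`, proved
without `sorry` and without new axioms.  NEW sibling module of unit `b2b-balaban-pv10` (gen 2); it imports
`…B16PostRGeom` (unit b02, gen 3) and through it `…B14DomainGeom` (unit pv02), and modifies nothing.

THE PRINTED TEXT.  B16 p. 378 [PDF 24]: *"We introduce the decompositions of unity  1 = χ_k((Ω_k^{~4})ᶜ) +
χ_k^c((Ω_k^{~4})ᶜ)  in components of Z. … For components of the first class, denoted by {X₁,…,X_n}, there are only the
characteristic functions χ_k(X_i^{~-6}), which are combined with the function χ_k(Ω_k^{~4}), here Ω_k is the old k-th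
domain."*  [III] (3.20) p. 269 [PDF 27]: *"Λ_{k+1} = Ω^{~-2}_{k+1} ∩ (R′^~_{k+1})ᶜ"* (typed in `…B14DomainGeom` as
`lambda320_subset_innerN`).  [III] p. 256 [PDF 14]: *"The domains Ω_j, Λ_j, which are determined by the j-th
renormalization transformation, but not by the 𝐑-operation, are unions of MR_j-cubes in the lattice T_{L^{-j}}. They
satisfy also other conditions, e.g., the distance between their boundaries is at least equal to 2MR_j"*.  [III] (2.3)
p. 255 [PDF 13]: *"… if a component of Z_j is contained in a cube of the size 100MR_j (in the L^{-j}-lattice), then it is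
a rectangular parallelepiped"*.  [IV] p. 177 [PDF 3]: *"According to our rule of construction of the large field regions,
for such a component all the regions connected with the last N steps are rectangular parallelepipeds."*

READING (declared, not printed; the conventions of `…B16PostRGeom` verbatim: one lattice `Pt d = ℤᵈ`, one cube family of
side `s`, `X~ⁿ = enl s n X`, `X~⁻ⁿ = innerN s n X`, `Ω` = the OLD k-th domain, `X j` the class-1 and `Y i` the class-2
components of `Z`).  The sibling module types the local picture as the EQUALITY `LocalCollar s Ω X : Ωᶜ ∩ X~⁴ = X~⁻²`.
This module splits it: the OUTER inclusion `OuterCollar s Ω X : Ωᶜ ∩ X~⁴ ⊆ X~⁻²` ("whatever part of the complement of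
the old domain lies within four layers of the component sits at least two layers inside it") and the INNER inclusion
`X~⁻² ⊆ Ωᶜ` ("the two-layer interior of the component is large-field for `Ω`").  Two configurations the printed
construction generates violate the INNER inclusion while satisfying the OUTER one, IF such sets occur as components of
`Z` (which depends on [IV] (1.14)–(1.20)'s determining-set domains, not re-derived by the cell — hence a typed remark,
not an objection): (α) a component of `Λ_kᶜ` generated by `R_k′~` alone, which by (3.20) lies inside `Ω_k~⁻²`
("island": `X~⁴ ⊆ Ω` in the extreme case, §D); (β) a small component replaced by its bounding parallelepiped
(the "rule of construction" behind (2.3) / [IV] p. 177) whose `Ωᶜ`-core `W` is not itself a box, so that `X ⊋ W~²`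
and the core is a proper part of `X~⁻²` (§C: `LocalCollar ⟺ W = X~⁻²`, `OuterCollar ⟺ W ⊆ X~⁻² ⟸ W~² ⊆ X`).

WHAT IS PROVED (all unconditional set algebra unless a hypothesis is displayed).
* §A `OuterCollar`; `LocalCollar → OuterCollar` (`outerCollar_of_localCollar`); under `OuterCollar` alone:
  `X \ X~⁻² ⊆ Ω`, `(Ω~⁴)ᶜ ∩ X~⁴ ⊆ X~⁻⁶` (`compl_enl4_inter_subset`), `X~⁴ ⊆ Ω~⁴ ∪ X~⁻⁶` (`enl4_subset`),
  and p. 378's COMBINED function as the cube-set identities `Ω~⁴ ∪ X = Ω~⁴ ∪ X~⁻⁶` (`union_eq`) and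
  `Ω~⁴ ∪ ((Ω~⁴)ᶜ ∩ X) = Ω~⁴ ∪ X~⁻⁶` (`combined_eq`: the decomposition of unity restricted to the component, recombined
  with `χ_k(Ω_k~⁴)`, constrains exactly the cubes of `Ω~⁴ ∪ X~⁻⁶` — with NO claim about the factor `(Ω~⁴)ᶜ ∩ X` alone).
* §B THE PRINTED SUPPORT IDENTITY under the outer collar only: `(Ω ∪ ⋃ⱼ X j)~⁴ = Ω~⁴ ∪ ⋃ⱼ X j~⁻⁶`
  (`leading_support_eq_of_outer`; the sibling's `leading_support_eq` assumes the equality `LocalCollar`).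
* §C SUFFICIENT CONDITIONS WITHOUT PARALLELEPIPEDS: `Ωᶜ ∩ X~⁴ ⊆ W` and `W~² ⊆ X` give `OuterCollar`
  (`outerCollar_of_core`; covers (β) and, with `W = ∅`, (α)); `W ⊆ (W~ⁿ)~⁻ⁿ` (`subset_innerN_enl`); with the core named,
  `OuterCollar ⟺ W ⊆ X~⁻²` and `LocalCollar ⟺ W = X~⁻²` (`outerCollar_iff_core`, `localCollar_iff_core`).
* §D THE ISLAND CASE: `X~⁴ ⊆ Ω` gives `OuterCollar` (`outerCollar_of_enl4_subset`) and, as soon as `X~⁻² ≠ ∅`,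
  REFUTES `LocalCollar` (`not_localCollar_of_enl4_subset`); a concrete `d = 1` instance (`island_instance`) shows the two
  typings differ on a consistent configuration.  (In case (α) the support identity of §B degenerates to `Ω~⁴ = Ω~⁴`, true.)
* §E READING INVARIANCE, one-sided: with the EFFECTIVE DOMAIN `Ω″ := (Ω ∩ ⋂ᵢ (Y i~⁻²)ᶜ) ∪ ⋃ⱼ X j` (`effectiveDomain`),
  reading (A) `Ωnew = Ω ∪ ⋃ⱼ X j` gives `Ωnew ∩ ⋂ᵢ (Y iᶜ)~² = Ω″` with NO collar hypothesis (`readingA_eq`, only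
  `X j ∩ Y i = ∅`), reading (B) `Ωnew = Ω ∪ Z` gives the same `Ω″` under `OuterCollar` at the `Y i` (`readingB_eq`);
  `Ω″ = Ω ∪ ⋃ⱼ X j` (the sibling's `Ω′`) iff additionally the INNER inclusion holds at every `Y i`
  (`effectiveDomain_eq_of_inner`); and the leading domain of (1.72) is `(Ω ∩ ⋂ᵢ (Y i~⁻²)ᶜ)~⁴ ∪ ⋃ⱼ X j~⁻⁶` under outer
  collars plus the explicit separation `X j~⁴ ∩ Y i~⁻² = ∅` (`leadingDomain_readingB_outer`; under the sibling's
  hypotheses that separation is automatic).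
WHAT IS *NOT* ASSERTED: that (α)- or (β)-sets ARE members of `Z` at an 𝐑-step (print does not say; [IV] (1.14)–(1.20));
anything the sibling's "WHAT IS NOT ASSERTED" lists; anything about characteristic functions beyond the cube SETS they
constrain ((2.17) [III]: `χ_k` of a union of cube sets is the product, so only the union matters).  Value = the sibling's
typed reading made robust (outer half load-bearing, inner half located as the part that can fail), NOT summit progress.
Companion rows: cell `GAPS.md` C-pv10-19 (c), G-B16-15, G-B16-15a (iii); `DIVERGENCE.md` D-b02.13 (iii).
-/

namespace Literature.MathematicalPhysics.QuantumFieldTheory.Balaban1983to89.B16OuterCollar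

open Literature.MathematicalPhysics.QuantumFieldTheory.Balaban1983to89.B14DomainGeom
open Literature.MathematicalPhysics.QuantumFieldTheory.Balaban1983to89.B16PostRGeom

variable {d : ℕ}

/-! ## A. The outer collar hypothesis and what it alone gives -/

/-- `OuterCollar s Ω X`: within four layers of the component `X`, the complement of the (old) k-th domain `Ω` lies in
the two-layer interior `X~⁻²` — the OUTER inclusion of the sibling's `LocalCollar s Ω X : Ωᶜ ∩ X~⁴ = X~⁻²`
(READING of "`Λ_k = Ω_k~⁻²` near `X`", [III] (3.20) p. 269, with other pieces of `Ωᶜ` farther than four layers).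
[folklore] -/
def OuterCollar (s : ℕ) (Ω X : Set (Pt d)) : Prop := Ωᶜ ∩ enl s 4 X ⊆ innerN s 2 X

/-- The sibling's equality hypothesis implies the outer inclusion. [folklore] -/
theorem outerCollar_of_localCollar {s : ℕ} {Ω X : Set (Pt d)} (h : LocalCollar s Ω X) : OuterCollar s Ω X := by
  intro x hx
  rw [← h]
  exact hx

namespace OuterCollar

variable {s : ℕ} {Ω X : Set (Pt d)}

/-- Under the outer collar a point of `X~⁴` outside `Ω` lies in `X~⁻²`. [folklore] -/
theorem mem_innerN2 (h : OuterCollar s Ω X) {x : Pt d} (hxΩ : x ∉ Ω) (hx : x ∈ enl s 4 X) :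
    x ∈ innerN s 2 X :=
  h ⟨hxΩ, hx⟩

/-- Under the outer collar the two outer layers `X \ X~⁻²` of the component lie in `Ω` (the sibling proves this from
the equality; only the outer inclusion is used). [folklore] -/
theorem diff_innerN2_subset (h : OuterCollar s Ω X) : X \ innerN s 2 X ⊆ Ω := by
  intro x hx
  by_contra hxΩ
  exact hx.2 (h ⟨hxΩ, subset_enl s 4 X hx.1⟩)

/-- **The load-bearing inclusion.**  Under the outer collar `(Ω~⁴)ᶜ ∩ X~⁴ ⊆ X~⁻⁶`: a point within four layers of `X`
but farther than four layers from `Ω` has its whole six-layer block inside `X` (clamp a point `z` at cube distance `≤ 6`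
to `w` at distance `≤ 4` from the point and `≤ 2` from `z`; `w ∈ Ω` is excluded, so `w ∈ Ωᶜ ∩ X~⁴ ⊆ X~⁻²`, whence
`z ∈ X`). [folklore] -/
theorem compl_enl4_inter_subset (hs : 0 < s) (h : OuterCollar s Ω X) :
    (enl s 4 Ω)ᶜ ∩ enl s 4 X ⊆ innerN s 6 X := by
  have key : ∀ x, x ∈ innerN s 6 X ↔ ∀ y, IdxNear s 4 x y → y ∈ innerN s 2 X := fun x => by
    simpa using mem_innerN_add_iff s 4 2 hs X x
  rintro y ⟨hyΩ4, hyX4⟩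
  have hyΩ : y ∉ Ω := fun hyΩ => hyΩ4 (subset_enl s 4 Ω hyΩ)
  have hyX : y ∈ X := innerN_subset s 2 X (h ⟨hyΩ, hyX4⟩)
  rw [key]
  intro w hw
  have hwX4 : w ∈ enl s 4 X := ⟨y, hyX, hw.symm⟩
  have hwΩ : w ∉ Ω := fun hwΩ => hyΩ4 ⟨w, hwΩ, hw⟩
  exact h ⟨hwΩ, hwX4⟩

/-- Under the outer collar `X~⁴ ⊆ Ω~⁴ ∪ X~⁻⁶` (sharper than the sibling's `X~⁴ ⊆ Ω~⁴ ∪ X`, and from the outer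
inclusion only). [folklore] -/
theorem enl4_subset (hs : 0 < s) (h : OuterCollar s Ω X) : enl s 4 X ⊆ enl s 4 Ω ∪ innerN s 6 X := by
  intro y hy
  by_cases hy4 : y ∈ enl s 4 Ω
  · exact Or.inl hy4
  · exact Or.inr (h.compl_enl4_inter_subset hs ⟨hy4, hy⟩)

/-- `(Ω~⁴)ᶜ ∩ X ⊆ X~⁻⁶` — the one-sided form of the sibling's factor-level identity `(Ω~⁴)ᶜ ∩ X = X~⁻⁶` (whose
other inclusion needs the inner half `X~⁻² ⊆ Ωᶜ` and fails for islands, §D). [folklore] -/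
theorem compl_enl4_inter_self_subset (hs : 0 < s) (h : OuterCollar s Ω X) :
    (enl s 4 Ω)ᶜ ∩ X ⊆ innerN s 6 X :=
  fun _ hx => h.compl_enl4_inter_subset hs ⟨hx.1, subset_enl s 4 X hx.2⟩

/-- **p. 378's combined function, as cube sets.**  Under the outer collar `Ω~⁴ ∪ X = Ω~⁴ ∪ X~⁻⁶`. [folklore] -/
theorem union_eq (hs : 0 < s) (h : OuterCollar s Ω X) : enl s 4 Ω ∪ X = enl s 4 Ω ∪ innerN s 6 X := by
  apply Set.Subset.antisymm
  · exact Set.union_subset Set.subset_union_left (fun x hx => h.enl4_subset hs (subset_enl s 4 X hx))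
  · exact Set.union_subset_union_right _ (innerN_subset s 6 X)

/-- The decomposition of unity `1 = χ_k((Ω_k~⁴)ᶜ) + χ_k^c((Ω_k~⁴)ᶜ)` restricted to a class-1 component and recombined
with `χ_k(Ω_k~⁴)` constrains exactly the cubes of `Ω~⁴ ∪ X~⁻⁶`: `Ω~⁴ ∪ ((Ω~⁴)ᶜ ∩ X) = Ω~⁴ ∪ X~⁻⁶` under the outer
collar alone (by (2.17) [III] only the union of the two cube sets matters for the product of the `χ_k`'s).
[folklore] -/
theorem combined_eq (hs : 0 < s) (h : OuterCollar s Ω X) :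
    enl s 4 Ω ∪ ((enl s 4 Ω)ᶜ ∩ X) = enl s 4 Ω ∪ innerN s 6 X := by
  rw [← h.union_eq hs]
  ext x
  simp only [Set.mem_union, Set.mem_inter_iff, Set.mem_compl_iff]
  tauto

/-- Restricting the domain: if `X~⁴ ⊆ T`, the outer collar for `Ω` gives the outer collar for `Ω ∩ T` (used in §E with
`T = ⋂ᵢ (Y i~⁻²)ᶜ`). [folklore] -/
theorem inter_domain (h : OuterCollar s Ω X) {T : Set (Pt d)} (hT : enl s 4 X ⊆ T) : OuterCollar s (Ω ∩ T) X := by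
  rintro x ⟨hxΩT, hx4⟩
  have hxΩ : x ∉ Ω := fun hxΩ => hxΩT ⟨hxΩ, hT hx4⟩
  exact h ⟨hxΩ, hx4⟩

end OuterCollar

/-! ## B. The printed support identity under the outer collar only -/

/-- **Support identity behind "combined with the function χ_k(Ω_k~⁴)", one-sided hypothesis.**  If every class-1
component has the OUTER collar, `(Ω ∪ ⋃ⱼ X j)~⁴ = Ω~⁴ ∪ ⋃ⱼ X j~⁻⁶` (the sibling's `leading_support_eq` under
`LocalCollar`; here from `Ωᶜ ∩ X j~⁴ ⊆ X j~⁻²` alone). [folklore] -/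
theorem leading_support_eq_of_outer (s : ℕ) (hs : 0 < s) (Ω : Set (Pt d)) {ι : Type*} (X : ι → Set (Pt d))
    (hX : ∀ j, OuterCollar s Ω (X j)) :
    enl s 4 (Ω ∪ ⋃ j, X j) = enl s 4 Ω ∪ ⋃ j, innerN s 6 (X j) := by
  rw [enl_union, enl_iUnion]
  apply Set.Subset.antisymm
  · apply Set.union_subset Set.subset_union_left
    intro x hx
    obtain ⟨j, hj⟩ := Set.mem_iUnion.mp hx
    rcases (hX j).enl4_subset hs hj with h4 | h6
    · exact Or.inl h4
    · exact Or.inr (Set.mem_iUnion.mpr ⟨j, h6⟩)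
  · apply Set.union_subset Set.subset_union_left
    intro x hx
    obtain ⟨j, hj⟩ := Set.mem_iUnion.mp hx
    exact Or.inr (Set.mem_iUnion.mpr ⟨j, subset_enl s 4 (X j) (innerN_subset s 6 (X j) hj)⟩)

/-! ## C. Sufficient conditions without parallelepipeds; the two typings in terms of the core -/

/-- `W ⊆ (W~ⁿ)~⁻ⁿ`: every point of `W` lies `n` layers inside the `n`-layer thickening of `W`. [folklore] -/
theorem subset_innerN_enl (s n : ℕ) (W : Set (Pt d)) : W ⊆ innerN s n (enl s n W) :=
  fun x hx => ⟨subset_enl s n W hx, fun _ hy => ⟨x, hx, hy.symm⟩⟩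

/-- **Outer collar from a core, no box needed.**  If the part of `Ωᶜ` within four layers of `X` is contained in a set `W`
whose two-layer thickening lies inside `X`, the outer collar holds.  Covers (β) (`X` the bounding parallelepiped of `W~²`,
any core `W`) and, with `W = ∅`, (α). [folklore] -/
theorem outerCollar_of_core {s : ℕ} {Ω X W : Set (Pt d)} (hΩ : Ωᶜ ∩ enl s 4 X ⊆ W) (hW : enl s 2 W ⊆ X) :
    OuterCollar s Ω X := by
  intro x hx
  have hxW : x ∈ W := hΩ hx
  exact ⟨hW (subset_enl s 2 W hxW), fun y hy => hW ⟨x, hxW, hy.symm⟩⟩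

/-- With the core named (`Ωᶜ ∩ X~⁴ = W`): the outer collar says `W ⊆ X~⁻²`. [folklore] -/
theorem outerCollar_iff_core {s : ℕ} {Ω X W : Set (Pt d)} (hΩ : Ωᶜ ∩ enl s 4 X = W) :
    OuterCollar s Ω X ↔ W ⊆ innerN s 2 X := by
  rw [OuterCollar, hΩ]

/-- With the core named (`Ωᶜ ∩ X~⁴ = W`): the sibling's `LocalCollar` says `W = X~⁻²` — for a bounding
parallelepiped `X ⊋ W~²` of a non-box core this demands that the core be the full shrunken box. [folklore] -/
theorem localCollar_iff_core {s : ℕ} {Ω X W : Set (Pt d)} (hΩ : Ωᶜ ∩ enl s 4 X = W) :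
    LocalCollar s Ω X ↔ W = innerN s 2 X := by
  rw [LocalCollar, hΩ]

/-- The sibling's box situation is a special case: `W` a set with `X = W~²` and `Ωᶜ ∩ X~⁴ = W` gives the outer collar
with no shape hypothesis on `W` at all (the sibling's `localCollar_of_box` needs `W` a rectangular parallelepiped to get
the equality). [folklore] -/
theorem outerCollar_of_core_eq {s : ℕ} {Ω X W : Set (Pt d)} (hX : X = enl s 2 W) (hΩ : Ωᶜ ∩ enl s 4 X = W) :
    OuterCollar s Ω X :=
  outerCollar_of_core hΩ.le (by rw [hX])

/-! ## D. The island case: the two typings differ -/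

/-- An island deep inside the old domain (`X~⁴ ⊆ Ω`, the extreme form of (α)) has the outer collar trivially.
[folklore] -/
theorem outerCollar_of_enl4_subset {s : ℕ} {Ω X : Set (Pt d)} (h4 : enl s 4 X ⊆ Ω) : OuterCollar s Ω X :=
  fun _ hx => absurd (h4 hx.2) hx.1

/-- … and violates the sibling's equality as soon as its two-layer interior is non-empty. [folklore] -/
theorem not_localCollar_of_enl4_subset {s : ℕ} {Ω X : Set (Pt d)} (h4 : enl s 4 X ⊆ Ω)
    (hne : (innerN s 2 X).Nonempty) : ¬ LocalCollar s Ω X := by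
  intro h
  obtain ⟨x, hx⟩ := hne
  have hx' : x ∈ Ωᶜ ∩ enl s 4 X := by
    rw [h]
    exact hx
  exact hx'.1 (h4 hx'.2)

/-- A consistent configuration on which the typings differ (`d = 1`, unit cubes, `Ω = ℤ`, `X = [2,7]~² = [0,9]`):
the outer collar holds and `LocalCollar` fails. [folklore] -/
theorem island_instance :
    OuterCollar 1 (Set.univ : Set (Pt 1)) (enl 1 2 (box 1 (fun _ => 2) (fun _ => 7))) ∧
      ¬ LocalCollar 1 (Set.univ : Set (Pt 1)) (enl 1 2 (box 1 (fun _ => 2) (fun _ => 7))) := by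
  have h4 : enl 1 4 (enl 1 2 (box 1 (fun _ : Fin 1 => (2 : ℤ)) (fun _ => 7))) ⊆ Set.univ :=
    Set.subset_univ _
  refine ⟨outerCollar_of_enl4_subset h4, not_localCollar_of_enl4_subset h4 ?_⟩
  rw [innerN_enl_box 1 2 one_pos _ _ (fun i => by norm_num)]
  exact ⟨fun _ => 2, fun i => by norm_num [cubeIdx]⟩

/-! ## E. Reading invariance and the leading domain of (1.72) under one-sided hypotheses -/

/-- The EFFECTIVE new k-th domain after the printed cut, one-sided version: `Ω″ = (Ω ∩ ⋂ᵢ (Y i~⁻²)ᶜ) ∪ ⋃ⱼ X j`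
(the old domain minus the class-2 two-layer interiors, plus the class-1 components). [folklore] -/
def effectiveDomain (s : ℕ) (Ω : Set (Pt d)) {ι κ : Type*} (X : ι → Set (Pt d)) (Y : κ → Set (Pt d)) :
    Set (Pt d) :=
  (Ω ∩ ⋂ i, (innerN s 2 (Y i))ᶜ) ∪ ⋃ j, X j

/-- The printed cut `⋂ᵢ (Y iᶜ)~²` is the complement of the union of the two-layer interiors. [folklore] -/
theorem cut_eq (s : ℕ) {κ : Type*} (Y : κ → Set (Pt d)) :
    (⋂ i, enl s 2 (Y i)ᶜ) = ⋂ i, (innerN s 2 (Y i))ᶜ := by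
  simp_rw [compl_innerN]

/-- **Reading (A)**, no collar hypothesis: `(Ω ∪ ⋃ⱼ X j) ∩ ⋂ᵢ (Y iᶜ)~² = Ω″` as soon as the classes are disjoint.
[folklore] -/
theorem readingA_eq (s : ℕ) (Ω : Set (Pt d)) {ι κ : Type*} (X : ι → Set (Pt d)) (Y : κ → Set (Pt d))
    (hXY : ∀ j i, Disjoint (X j) (Y i)) :
    (Ω ∪ ⋃ j, X j) ∩ (⋂ i, enl s 2 (Y i)ᶜ) = effectiveDomain s Ω X Y := by
  rw [cut_eq]
  ext x
  simp only [effectiveDomain, Set.mem_inter_iff, Set.mem_union, Set.mem_iInter, Set.mem_iUnion,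
    Set.mem_compl_iff]
  constructor
  · rintro ⟨hx | ⟨j, hj⟩, hcut⟩
    · exact Or.inl ⟨hx, hcut⟩
    · exact Or.inr ⟨j, hj⟩
  · rintro (⟨hx, hcut⟩ | ⟨j, hj⟩)
    · exact ⟨Or.inl hx, hcut⟩
    · exact ⟨Or.inr ⟨j, hj⟩, fun i hi => Set.disjoint_left.mp (hXY j i) hj (innerN_subset s 2 (Y i) hi)⟩

/-- **Reading (B)** under the OUTER collar at the class-2 components: `(Ω ∪ ⋃ⱼ X j ∪ ⋃ᵢ Y i) ∩ ⋂ᵢ (Y iᶜ)~² = Ω″`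
(the cut removes the class-2 interiors; their outer two layers are in `Ω` by `OuterCollar.diff_innerN2_subset`).
[folklore] -/
theorem readingB_eq (s : ℕ) (Ω : Set (Pt d)) {ι κ : Type*} (X : ι → Set (Pt d)) (Y : κ → Set (Pt d))
    (hY : ∀ i, OuterCollar s Ω (Y i)) (hXY : ∀ j i, Disjoint (X j) (Y i)) :
    (Ω ∪ (⋃ j, X j) ∪ ⋃ i, Y i) ∩ (⋂ i, enl s 2 (Y i)ᶜ) = effectiveDomain s Ω X Y := by
  have hA := readingA_eq s Ω X Y hXY
  apply Set.Subset.antisymm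
  · rintro x ⟨hx, hcut⟩
    rcases hx with hx | hxY
    · rw [← hA]
      exact ⟨hx, hcut⟩
    · obtain ⟨i, hi⟩ := Set.mem_iUnion.mp hxY
      have hxi : x ∉ innerN s 2 (Y i) := by
        have hc := Set.mem_iInter.mp hcut i
        rwa [← compl_innerN, Set.mem_compl_iff] at hc
      have hxΩ : x ∈ Ω := (hY i).diff_innerN2_subset ⟨hi, hxi⟩
      rw [← hA]
      exact ⟨Or.inl hxΩ, hcut⟩
  · intro x hx
    rw [← hA] at hx
    exact ⟨Or.inl hx.1, hx.2⟩

/-- `Ω″` is the sibling's `Ω′ = Ω ∪ ⋃ⱼ X j` iff, in addition, the INNER inclusion `Y i~⁻² ⊆ Ωᶜ` holds at every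
class-2 component (then the cut removes nothing from `Ω`). [folklore] -/
theorem effectiveDomain_eq_of_inner (s : ℕ) (Ω : Set (Pt d)) {ι κ : Type*} (X : ι → Set (Pt d))
    (Y : κ → Set (Pt d)) (hYin : ∀ i, innerN s 2 (Y i) ⊆ Ωᶜ) :
    effectiveDomain s Ω X Y = Ω ∪ ⋃ j, X j := by
  have hΩ : Ω ∩ (⋂ i, (innerN s 2 (Y i))ᶜ) = Ω :=
    Set.inter_eq_left.mpr (Set.subset_iInter fun i x hx hxi => hYin i hxi hx)
  rw [effectiveDomain, hΩ]

/-- In general `Ω″ ⊆ Ω′`, the difference being `Ω ∩ ⋃ᵢ Y i~⁻²`. [folklore] -/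
theorem effectiveDomain_subset (s : ℕ) (Ω : Set (Pt d)) {ι κ : Type*} (X : ι → Set (Pt d))
    (Y : κ → Set (Pt d)) : effectiveDomain s Ω X Y ⊆ Ω ∪ ⋃ j, X j :=
  Set.union_subset_union_left _ Set.inter_subset_left

/-- **The leading domain of (1.72) under one-sided hypotheses.**  With outer collars at all components, disjoint
classes, and the explicit separation `X j~⁴ ∩ Y i~⁻² = ∅` (automatic under the sibling's hypotheses), the leading
domain for reading (B) is `(Ω ∩ ⋂ᵢ (Y i~⁻²)ᶜ)~⁴ ∪ ⋃ⱼ X j~⁻⁶`. [folklore] -/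
theorem leadingDomain_readingB_outer (s : ℕ) (hs : 0 < s) (Ω : Set (Pt d)) {ι κ : Type*} (X : ι → Set (Pt d))
    (Y : κ → Set (Pt d)) (hX : ∀ j, OuterCollar s Ω (X j)) (hY : ∀ i, OuterCollar s Ω (Y i))
    (hXY : ∀ j i, Disjoint (X j) (Y i)) (hsep : ∀ j i, Disjoint (enl s 4 (X j)) (innerN s 2 (Y i))) :
    leadingDomain s (Ω ∪ (⋃ j, X j) ∪ ⋃ i, Y i) Y =
      enl s 4 (Ω ∩ ⋂ i, (innerN s 2 (Y i))ᶜ) ∪ ⋃ j, innerN s 6 (X j) := by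
  unfold leadingDomain
  rw [readingB_eq s Ω X Y hY hXY, effectiveDomain]
  exact leading_support_eq_of_outer s hs _ X
    (fun j => (hX j).inter_domain (Set.subset_iInter fun i => (hsep j i).subset_compl_right))

/-- Under the sibling's hypotheses the separation is automatic: the inner inclusion at `Y i` and the outer collar at
`X j` give `X j~⁴ ∩ Y i~⁻² = ∅` for disjoint classes. [folklore] -/
theorem sep_of_inner (s : ℕ) {Ω : Set (Pt d)} {ι κ : Type*} (X : ι → Set (Pt d)) (Y : κ → Set (Pt d))
    (hX : ∀ j, OuterCollar s Ω (X j)) (hYin : ∀ i, innerN s 2 (Y i) ⊆ Ωᶜ)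
    (hXY : ∀ j i, Disjoint (X j) (Y i)) (j : ι) (i : κ) :
    Disjoint (enl s 4 (X j)) (innerN s 2 (Y i)) := by
  refine Set.disjoint_left.mpr fun x hx4 hxi => ?_
  have hxX : x ∈ X j := innerN_subset s 2 (X j) ((hX j) ⟨hYin i hxi, hx4⟩)
  exact Set.disjoint_left.mp (hXY j i) hxX (innerN_subset s 2 (Y i) hxi)

end Literature.MathematicalPhysics.QuantumFieldTheory.Balaban1983to89.B16OuterCollar
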